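import Summits.HodgeConjecture.HodgeConjecture.Theorems.F0P2aCmFrameFactorisation
import Summits.HodgeConjecture.HodgeConjecture.Theorems.H413SpectrumJunction
import Mathlib.MeasureTheory.Function.LpSpace.ContinuousFunctions
import HarnessLib

/-!
# FLOOR-0 P2a · B4-ARCHIMEDEAN DESK, line 2 `F0_P2aCohIsotypicLine` — support B5: the `(1,0) ⊕ (0,1)` cotangent automorphic forms of the
# CM FRAME `(L, ι, H, T, hT)` are CONTINUOUS on `U(H)(𝔸_{L⁺})` (generic-frame form of ★ `P2StubU2lL2Realisation.continuous_of_mem_cohForms`)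

Cell hodgecm-mathlib (D-0151), FLOOR 0; crux item H413 = stmt-HodgeConjecture-24833 (route `HCCMUnconditional`); line
`Cruxes/H413/Lines/F0_P2aCohIsotypicLine.lean` (F0P2a-plan (g2), sha16 fe64be0a9875628f), seat F0P2a-p03 (g0), desk support **B5**
(PLAN-P2a v2 §1: «coh forms are continuous on `U(H)(𝔸)`», the regularity input of S2β `stub_density` and of the `hcont` binders).
THEOREMS ONLY (no `def`, no instance, no notation, no named fact, no `sorry`); `--supports stmt-HodgeConjecture-24833`.
HC_CM is proved only modulo the 7 printed citations until rung 0 closes; this file discharges none of them.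

## What is proved
For a CM field `L`, `H ∈ M₃(L)` and a frame `T ∈ GL₃(ℂ)` with `Tᴴ · ι(H) · T = diag(1,1,-1)` — the CM archimedean factor
`(cmArchSection L ι H T hT, cmCompactFactor L ι H T hT)` of ★ `Automorphic/UnitaryGroupCohomologicalForms` §5 — every
`Φ ∈ CotangentForms.cohForms L⁺ L c̄ 3 H (cmArchSection …) (cmCompactFactor …)` is a CONTINUOUS function `U(H)(𝔸_{L⁺}) → ℂ²`
(`continuous_of_mem_holCotForms_cm`, `continuous_of_mem_cohForms_cm`; NO definiteness / degree hypothesis), hence its coordinates are continuous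
(`continuous_apply_of_mem_cohForms_cm`), are in `L^p` of every finite measure on a compact automorphic quotient (`memLp_toQuotFun_of_mem_cohForms_cm`),
and a non-zero form has a non-zero `L^p`-class for a measure positive on opens (`toLp_toQuotFun_ne_zero_of_mem_cohForms_cm`,
`exists_toLp_ne_zero_of_mem_cohForms_cm`, `eq_zero_of_forall_toLp_eq_zero_cm` — the last step of S2β).
PROOF ([BorelJacquet1979, §4.1–4.2]): a holomorphic cotangent form is right-invariant under an OPEN `K_f ≤ U(H)(𝔸_{L⁺,f})`
(★ `F0P2aCmFrameFactorisation.exists_isOpen_forall_rightRep_eq`) and right-`K_c`-invariant, so by the frame factorisation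
(★ `F0P2aCmFrameFactorisation.apply_eq_apply_cmSlice`) it is, near `x`, the CONTINUOUS `U(2,1)`-slice through `(1, x_f)`
(★ `F0P2aCmFrameFactorisation.continuous_slice`: slices are group functions of holomorphic ball functions) composed with the continuous
projection `y ↦ pr_ι (y_∞)`; `cohForms = hol ⊕ conj hol`.

## References
* [BorelJacquet1979] A. Borel, H. Jacquet, Corvallis PSPM 33.1, §4.1–4.2, §4.6.  [Borel1997] A. Borel, *Automorphic forms on SL₂(ℝ)*, §5.14.
* [BorelWallach2000] A. Borel, N. Wallach, 2nd ed., VII 2.10.  [GelfandGraevPiatetskiShapiro1969] Ch. 1 §2.3 (compact quotient).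
* Tree: ★ `Theorems/F0P2aCmFrameFactorisation` (slices, frame factorisation), ★ `Theorems/P2StubU2lL2Realisation` (the pin version),
  ★ `Theorems/H413SpectrumJunction` (`memLp_toQuotFun`, `toLp_toQuotFun_ne_zero`, `leftInvariant_of_mem_cohForms`).
-/

set_option autoImplicit false

-- the mandated namespace has the single-problem summit's repeated segment (`HodgeConjecture.HodgeConjecture`)
set_option linter.dupNamespace false

noncomputable section

namespace Summit.HodgeConjecture.HodgeConjecture.Cruxes.H413.F0P2aCohFormsContinuous

open MeasureTheory NumberField NumberField.InfinitePlace MulAction Topology Filter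
open scoped ENNReal Matrix ComplexOrder
open Literature.NumberTheory.Automorphic Literature.NumberTheory.Automorphic.UnitaryGroup
open Literature.NumberTheory.Automorphic.UnitaryGroup.CotangentForms (toQuotFun cmArchSection cmCompactFactor)
open Summit.HodgeConjecture.HodgeConjecture.Cruxes.H413.F0P2aCmFrameFactorisation

/-! ## Continuity of the cotangent forms of the frame on `U(H)(𝔸_{L⁺})` and its `L²` consequences -/

section Continuity

variable (L : Type) [Field L] [NumberField L] [IsCMField L] (ι : L →+* ℂ) (H : Matrix (Fin 3) (Fin 3) L) (T : GL (Fin 3) ℂ)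
  (hT : (T : Matrix (Fin 3) (Fin 3) ℂ)ᴴ * H.map ι * (T : Matrix (Fin 3) (Fin 3) ℂ) = Literature.Geometry.ComplexHyperbolic.BallModel.J)

/-- **Holomorphic cotangent forms of the CM frame are continuous on `U(H)(𝔸_{L⁺})`** (no definiteness / degree hypothesis).
[cite: BorelJacquet1979, §4.1–4.2] [cite: Borel1997, §5.14] -/
theorem continuous_of_mem_holCotForms_cm
    {f : (adelicGroupData (↥(maximalRealSubfield L)) L (IsCMField.complexConj L) 3 H).Adelic → (Fin 2 → ℂ)}
    (hf : f ∈ CotangentForms.holCotForms (↥(maximalRealSubfield L)) L (IsCMField.complexConj L) 3 H (cmArchSection L ι H T hT)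
      (cmCompactFactor L ι H T hT)) :
    Continuous f := by
  obtain ⟨hW, hK, hS, hH⟩ := CotangentForms.mem_holCotForms_iff.1 hf
  obtain ⟨Kf, hKo, hKf⟩ := exists_isOpen_forall_rightRep_eq hS
  have hP : Continuous fun y : (adelicGroupData (↥(maximalRealSubfield L)) L (IsCMField.complexConj L) 3 H).Adelic =>
      archProjU21EmbCM L H ι T (formCongr_eq_of_conjTranspose L ι H T hT)
        (archPart (↥(maximalRealSubfield L)) L (IsCMField.complexConj L) 3 H y) :=
    (continuous_archProjU21EmbCM L H ι T _).comp (continuous_archPart (↥(maximalRealSubfield L)) L (IsCMField.complexConj L) 3 H)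
  refine continuous_iff_continuousAt.2 fun x => ?_
  -- the continuous candidate near `x`: the slice through `(1, x_f)` composed with `y ↦ pr (y_∞)`
  have hslice := continuous_slice (cmArchSection L ι H T hT) hW hH
    (finAdelicToAdelic (↥(maximalRealSubfield L)) L (IsCMField.complexConj L) 3 H
      (finPart (↥(maximalRealSubfield L)) L (IsCMField.complexConj L) 3 H x))
  have hN : ∀ᶠ y in 𝓝 x, finPart (↥(maximalRealSubfield L)) L (IsCMField.complexConj L) 3 H (x⁻¹ * y) ∈ Kf := by
    have hc : Continuous fun y : (adelicGroupData (↥(maximalRealSubfield L)) L (IsCMField.complexConj L) 3 H).Adelic =>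
        finPart (↥(maximalRealSubfield L)) L (IsCMField.complexConj L) 3 H (x⁻¹ * y) :=
      (continuous_finPart (↥(maximalRealSubfield L)) L (IsCMField.complexConj L) 3 H).comp (continuous_const.mul continuous_id)
    refine hc.continuousAt.eventually_mem (hKo.mem_nhds ?_)
    show finPart (↥(maximalRealSubfield L)) L (IsCMField.complexConj L) 3 H (x⁻¹ * x) ∈
      (Kf : Set (finAdelic (↥(maximalRealSubfield L)) L (IsCMField.complexConj L) 3 H))
    rw [inv_mul_cancel, map_one]
    exact Kf.one_mem
  have heq : (fun y => f (finAdelicToAdelic (↥(maximalRealSubfield L)) L (IsCMField.complexConj L) 3 H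
        (finPart (↥(maximalRealSubfield L)) L (IsCMField.complexConj L) 3 H x) *
      cmArchSection L ι H T hT (archProjU21EmbCM L H ι T (formCongr_eq_of_conjTranspose L ι H T hT)
        (archPart (↥(maximalRealSubfield L)) L (IsCMField.complexConj L) 3 H y)))) =ᶠ[𝓝 x] f := by
    filter_upwards [hN] with y hy
    rw [apply_eq_apply_cmSlice L ι H T hT hK y]
    have e : finPart (↥(maximalRealSubfield L)) L (IsCMField.complexConj L) 3 H y =
        finPart (↥(maximalRealSubfield L)) L (IsCMField.complexConj L) 3 H x *
          finPart (↥(maximalRealSubfield L)) L (IsCMField.complexConj L) 3 H (x⁻¹ * y) := by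
      rw [← map_mul, mul_inv_cancel_left]
    have e2 : finAdelicToAdelic (↥(maximalRealSubfield L)) L (IsCMField.complexConj L) 3 H
          (finPart (↥(maximalRealSubfield L)) L (IsCMField.complexConj L) 3 H y) *
        cmArchSection L ι H T hT (archProjU21EmbCM L H ι T (formCongr_eq_of_conjTranspose L ι H T hT)
          (archPart (↥(maximalRealSubfield L)) L (IsCMField.complexConj L) 3 H y)) =
        finAdelicToAdelic (↥(maximalRealSubfield L)) L (IsCMField.complexConj L) 3 H
            (finPart (↥(maximalRealSubfield L)) L (IsCMField.complexConj L) 3 H x) *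
          cmArchSection L ι H T hT (archProjU21EmbCM L H ι T (formCongr_eq_of_conjTranspose L ι H T hT)
            (archPart (↥(maximalRealSubfield L)) L (IsCMField.complexConj L) 3 H y)) *
          finAdelicToAdelic (↥(maximalRealSubfield L)) L (IsCMField.complexConj L) 3 H
            (finPart (↥(maximalRealSubfield L)) L (IsCMField.complexConj L) 3 H (x⁻¹ * y)) := by
      rw [e, map_mul, mul_assoc, mul_assoc, cmArchSection_mul_finAdelicToAdelic]
    have hm := congrFun (hKf _ hy)
      (finAdelicToAdelic (↥(maximalRealSubfield L)) L (IsCMField.complexConj L) 3 H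
            (finPart (↥(maximalRealSubfield L)) L (IsCMField.complexConj L) 3 H x) *
          cmArchSection L ι H T hT (archProjU21EmbCM L H ι T (formCongr_eq_of_conjTranspose L ι H T hT)
            (archPart (↥(maximalRealSubfield L)) L (IsCMField.complexConj L) 3 H y)))
    rw [CotangentForms.rightRep_apply] at hm
    rw [e2, hm]
  exact (hslice.comp hP).continuousAt.congr heq

/-- **The `(1,0) ⊕ (0,1)` cohomological cotangent forms of the CM frame are continuous on `U(H)(𝔸_{L⁺})`** (`cohForms = hol ⊕ conj hol`,
conjugation is continuous).  = the `B5` support of line 2; verbatim generic-frame form of ★ `P2StubU2lL2Realisation.continuous_of_mem_cohForms`.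
[cite: BorelWallach2000, VII 2.10] [cite: BorelJacquet1979, §4.2] -/
theorem continuous_of_mem_cohForms_cm
    {f : (adelicGroupData (↥(maximalRealSubfield L)) L (IsCMField.complexConj L) 3 H).Adelic → (Fin 2 → ℂ)}
    (hf : f ∈ CotangentForms.cohForms (↥(maximalRealSubfield L)) L (IsCMField.complexConj L) 3 H (cmArchSection L ι H T hT)
      (cmCompactFactor L ι H T hT)) :
    Continuous f := by
  obtain ⟨f₁, hf₁, f₂, hf₂, rfl⟩ := Submodule.mem_sup.1 hf
  obtain ⟨g, hg, rfl⟩ := Submodule.mem_map.1 hf₂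
  have hg' : Continuous fun x => star (g x) := continuous_star.comp (continuous_of_mem_holCotForms_cm L ι H T hT hg)
  exact (continuous_of_mem_holCotForms_cm L ι H T hT hf₁).add hg'

/-- **B5 in the binder shape of S2β's fold** (F0P2a-p05's ★ `F0P2aStubDensity.densityType_of_continuous`, hypothesis `hcont`, verbatim; the
definiteness binder is not used): for every CM frame, every cohomological cotangent form is continuous.  So
`densityType_of_continuous continuous_of_mem_cohForms_frame` is the body of the line's `DensityType`. [cite: BorelJacquet1979, §4.2] -/
theorem continuous_of_mem_cohForms_frame :
    ∀ (L : Type) [Field L] [NumberField L] [IsCMField L] (ι : L →+* ℂ) (H : Matrix (Fin 3) (Fin 3) L) (T : GL (Fin 3) ℂ)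
      (hT : (T : Matrix (Fin 3) (Fin 3) ℂ)ᴴ * H.map ι * (T : Matrix (Fin 3) (Fin 3) ℂ) = Literature.Geometry.ComplexHyperbolic.BallModel.J),
      (∀ τ' : L →+* ℂ, InfinitePlace.mk τ' ≠ InfinitePlace.mk ι → (H.map τ').PosDef) →
      ∀ Φ ∈ CotangentForms.cohForms (↥(maximalRealSubfield L)) L (IsCMField.complexConj L) 3 H (cmArchSection L ι H T hT)
        (cmCompactFactor L ι H T hT), Continuous Φ :=
  fun L _ _ _ ι H T hT _ _ hΦ => continuous_of_mem_cohForms_cm L ι H T hT hΦ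

/-- **Coordinates of cohomological cotangent forms of the frame are continuous** (the shape consumed by the junction lemmas and by S2β).
[cite: BorelJacquet1979, §4.2] -/
theorem continuous_apply_of_mem_cohForms_cm
    {f : (adelicGroupData (↥(maximalRealSubfield L)) L (IsCMField.complexConj L) 3 H).Adelic → (Fin 2 → ℂ)}
    (hf : f ∈ CotangentForms.cohForms (↥(maximalRealSubfield L)) L (IsCMField.complexConj L) 3 H (cmArchSection L ι H T hT)
      (cmCompactFactor L ι H T hT)) (j : Fin 2) :
    Continuous fun x => f x j :=
  (continuous_apply j).comp (continuous_of_mem_cohForms_cm L ι H T hT hf)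

/-- Coordinates of HOLOMORPHIC cotangent forms of the frame are continuous. [cite: BorelJacquet1979, §4.2] -/
theorem continuous_apply_of_mem_holCotForms_cm
    {f : (adelicGroupData (↥(maximalRealSubfield L)) L (IsCMField.complexConj L) 3 H).Adelic → (Fin 2 → ℂ)}
    (hf : f ∈ CotangentForms.holCotForms (↥(maximalRealSubfield L)) L (IsCMField.complexConj L) 3 H (cmArchSection L ι H T hT)
      (cmCompactFactor L ι H T hT)) (j : Fin 2) :
    Continuous fun x => f x j :=
  (continuous_apply j).comp (continuous_of_mem_holCotForms_cm L ι H T hT hf)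

variable {L ι H T hT}

/-- **`L^p` of the descended coordinates on a compact quotient**: for a finite measure `μ` on a COMPACT automorphic quotient
`U(H)(L⁺)\U(H)(𝔸_{L⁺})` (e.g. `H` anisotropic), every descended coordinate `[g] ↦ f(g⁻¹) j` of `f ∈ cohForms` of the frame is in `L^p(μ)`
(★ `SpectrumJunction.memLp_toQuotFun`, continuity + left-invariance discharged). [cite: GelfandGraevPiatetskiShapiro1969, Ch. 1 §2.3] -/
theorem memLp_toQuotFun_of_mem_cohForms_cm
    [CompactSpace (adelicGroupData (↥(maximalRealSubfield L)) L (IsCMField.complexConj L) 3 H).automorphicQuotient]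
    {μ : Measure (adelicGroupData (↥(maximalRealSubfield L)) L (IsCMField.complexConj L) 3 H).automorphicQuotient} [IsFiniteMeasure μ]
    {f : (adelicGroupData (↥(maximalRealSubfield L)) L (IsCMField.complexConj L) 3 H).Adelic → (Fin 2 → ℂ)}
    (hf : f ∈ CotangentForms.cohForms (↥(maximalRealSubfield L)) L (IsCMField.complexConj L) 3 H (cmArchSection L ι H T hT)
      (cmCompactFactor L ι H T hT)) (j : Fin 2) (p : ℝ≥0∞) :
    MemLp (toQuotFun (adelicGroupData (↥(maximalRealSubfield L)) L (IsCMField.complexConj L) 3 H) fun x => f x j) p μ :=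
  SpectrumJunction.memLp_toQuotFun (fun γ hγ x => by simp only [SpectrumJunction.leftInvariant_of_mem_cohForms hf γ hγ x])
    (continuous_apply_of_mem_cohForms_cm L ι H T hT hf j) p

/-- **A non-zero coordinate of a cotangent form of the frame has a non-zero `L^p`-class** whenever `μ` is positive on non-empty open sets
(e.g. automorphic): ★ `SpectrumJunction.toLp_toQuotFun_ne_zero` with continuity and left-invariance discharged. [cite: BorelJacquet1979, §4.6] -/
theorem toLp_toQuotFun_ne_zero_of_mem_cohForms_cm
    {μ : Measure (adelicGroupData (↥(maximalRealSubfield L)) L (IsCMField.complexConj L) 3 H).automorphicQuotient} [μ.IsOpenPosMeasure]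
    {f : (adelicGroupData (↥(maximalRealSubfield L)) L (IsCMField.complexConj L) 3 H).Adelic → (Fin 2 → ℂ)}
    (hf : f ∈ CotangentForms.cohForms (↥(maximalRealSubfield L)) L (IsCMField.complexConj L) 3 H (cmArchSection L ι H T hT)
      (cmCompactFactor L ι H T hT)) (j : Fin 2) (hj : (fun x => f x j) ≠ 0) {p : ℝ≥0∞}
    (hm : MemLp (toQuotFun (adelicGroupData (↥(maximalRealSubfield L)) L (IsCMField.complexConj L) 3 H) fun x => f x j) p μ) :
    hm.toLp (toQuotFun (adelicGroupData (↥(maximalRealSubfield L)) L (IsCMField.complexConj L) 3 H) fun x => f x j) ≠ 0 :=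
  SpectrumJunction.toLp_toQuotFun_ne_zero (fun γ hγ x => by simp only [SpectrumJunction.leftInvariant_of_mem_cohForms hf γ hγ x])
    (continuous_apply_of_mem_cohForms_cm L ι H T hT hf j) hm hj

/-- **A NON-ZERO cotangent form of the frame with square-integrable coordinates has SOME non-zero coordinate class** (`μ` positive on opens).
[cite: BorelJacquet1979, §4.6] -/
theorem exists_toLp_ne_zero_of_mem_cohForms_cm
    {μ : Measure (adelicGroupData (↥(maximalRealSubfield L)) L (IsCMField.complexConj L) 3 H).automorphicQuotient} [μ.IsOpenPosMeasure]
    {f : (adelicGroupData (↥(maximalRealSubfield L)) L (IsCMField.complexConj L) 3 H).Adelic → (Fin 2 → ℂ)}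
    (hf : f ∈ CotangentForms.cohForms (↥(maximalRealSubfield L)) L (IsCMField.complexConj L) 3 H (cmArchSection L ι H T hT)
      (cmCompactFactor L ι H T hT)) (hne : f ≠ 0) {p : ℝ≥0∞}
    (hm : ∀ j : Fin 2, MemLp (toQuotFun (adelicGroupData (↥(maximalRealSubfield L)) L (IsCMField.complexConj L) 3 H) fun x => f x j) p μ) :
    ∃ j : Fin 2, (hm j).toLp (toQuotFun (adelicGroupData (↥(maximalRealSubfield L)) L (IsCMField.complexConj L) 3 H) fun x => f x j) ≠ 0 := by
  obtain ⟨x, hx⟩ := Function.ne_iff.1 hne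
  obtain ⟨j, hj⟩ := Function.ne_iff.1 hx
  have hj' : (fun g => f g j) ≠ 0 := fun h0 => hj (by simpa using congrFun h0 x)
  exact ⟨j, toLp_toQuotFun_ne_zero_of_mem_cohForms_cm hf j hj' (hm j)⟩

/-- **Coordinatewise contrapositive** (the shape of S2β's last step): if every coordinate class of `f ∈ cohForms` of the frame vanishes in `L^p(μ)`
(`μ` positive on opens) then `f = 0`. [cite: BorelJacquet1979, §4.6] -/
theorem eq_zero_of_forall_toLp_eq_zero_cm
    {μ : Measure (adelicGroupData (↥(maximalRealSubfield L)) L (IsCMField.complexConj L) 3 H).automorphicQuotient} [μ.IsOpenPosMeasure]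
    {f : (adelicGroupData (↥(maximalRealSubfield L)) L (IsCMField.complexConj L) 3 H).Adelic → (Fin 2 → ℂ)}
    (hf : f ∈ CotangentForms.cohForms (↥(maximalRealSubfield L)) L (IsCMField.complexConj L) 3 H (cmArchSection L ι H T hT)
      (cmCompactFactor L ι H T hT)) {p : ℝ≥0∞}
    (hm : ∀ j : Fin 2, MemLp (toQuotFun (adelicGroupData (↥(maximalRealSubfield L)) L (IsCMField.complexConj L) 3 H) fun x => f x j) p μ)
    (h0 : ∀ j : Fin 2, (hm j).toLp (toQuotFun (adelicGroupData (↥(maximalRealSubfield L)) L (IsCMField.complexConj L) 3 H) fun x => f x j) = 0) :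
    f = 0 := by
  by_contra hne
  obtain ⟨j, hj⟩ := exists_toLp_ne_zero_of_mem_cohForms_cm hf hne hm
  exact hj (h0 j)

end Continuity

end Summit.HodgeConjecture.HodgeConjecture.Cruxes.H413.F0P2aCohFormsContinuous

end
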